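import Literature.Probability.FitznerVanDerHofstad2017.SrwISeedTail
import Literature.Probability.FitznerVanDerHofstad2017.SrwISeedTailSummable
import Literature.Probability.FitznerVanDerHofstad2017.SrwISeedTailValue
import HarnessLib

/-!
# The seed enclosure with a block / far-tail majorant — no analytic hypotheses left

Assembly of `srwI_succ_mem_Icc` (series form + x-blind tail), the summability companion and the
closed-form far-tail value bound: given ANY block majorant `b m ≥ q_m` on `M ≤ m < M₁` (e.g. instances of
`srwLaw_le_blockConst`) and a power law `q_m ≤ K m^{-d/2}` on `m ≥ M₁` (e.g.
`srwLaw_two_mul_zero_le_const_mul_rpow`), the seed `I_{n+1,0}(x)` (`d ≥ 2n+3`) lies in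
`[S, S + Σ_{m∈[M,M₁)} C(2m+n,n) b m + FAR + Σ_{m∈[M,M₁)} C(2m+1+n,n) b m + FAR]`,
`S = Σ_{i<2M} C(i+n,n) p_i(x)`, `FAR = K (3+n)^n (M₁^{-(d/2-n)} + M₁^{1-(d/2-n)}/(d/2-n-1))`.
This is the analytic half of the term-wise seed certificate SEEDCERT-P in one statement: what remains for a
kernel certificate of one seed is the choice of parameters and rational arithmetic. [folklore]
-/

namespace Literature.Probability.FitznerVanDerHofstad2017

open Finset
open Literature.Barriers.CriticalPhenomena.LongRangePhi4

variable {d : ℕ}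

/-- **Seed enclosure with block / far-tail majorant.** [folklore] -/
theorem srwI_succ_mem_Icc_blockFarTail (n : ℕ) (hd : 2 * n + 3 ≤ d) (x : Fin d → ℤ)
    {M M₁ : ℕ} (hM : 1 ≤ M) (hMM₁ : M ≤ M₁)
    {b : ℕ → ℝ} (hb : ∀ m, M ≤ m → m < M₁ → srwLaw d (2 * m) 0 ≤ b m)
    {K : ℝ} (hK : 0 ≤ K)
    (hfar : ∀ m, M₁ ≤ m → srwLaw d (2 * m) 0 ≤ K * (m : ℝ) ^ (-((d : ℝ) / 2))) :
    srwI d (n + 1) 0 x ∈ Set.Icc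
      (∑ i ∈ range (2 * M), (((i + n).choose n : ℕ) : ℝ) * srwLaw d i x)
      (∑ i ∈ range (2 * M), (((i + n).choose n : ℕ) : ℝ) * srwLaw d i x +
        ((∑ m ∈ Finset.Ico M M₁, (((2 * m + n).choose n : ℕ) : ℝ) * b m +
            K * ((3 : ℝ) + n) ^ n * (((M₁ : ℕ) : ℝ) ^ (-((d : ℝ) / 2 - n)) +
              ((M₁ : ℕ) : ℝ) ^ (1 - ((d : ℝ) / 2 - n)) / ((d : ℝ) / 2 - n - 1))) +
          (∑ m ∈ Finset.Ico M M₁, (((2 * m + 1 + n).choose n : ℕ) : ℝ) * b m +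
            K * ((3 : ℝ) + n) ^ n * (((M₁ : ℕ) : ℝ) ^ (-((d : ℝ) / 2 - n)) +
              ((M₁ : ℕ) : ℝ) ^ (1 - ((d : ℝ) / 2 - n)) / ((d : ℝ) / 2 - n - 1))))) := by
  -- the majorant
  set s : ℝ := (d : ℝ) / 2 with hs_def
  have hs : (n : ℝ) + 1 < s := by
    have : (2 * n + 3 : ℝ) ≤ d := by exact_mod_cast hd
    rw [hs_def]; linarith
  let B : ℕ → ℝ := fun m => if m < M₁ then max (b m) 0 else K * (m : ℝ) ^ (-s)
  have hB0 : ∀ m, 0 ≤ B m := by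
    intro m; by_cases h : m < M₁
    · simp [B, h]
    · simp only [B, h, if_false]; positivity
  have hBq : ∀ j, srwLaw d (2 * (M + j)) 0 ≤ B (M + j) := by
    intro j; by_cases h : M + j < M₁
    · simp only [B, h, if_true]; exact (hb _ (by omega) h).trans (le_max_left _ _)
    · simp only [B, h, if_false]; exact hfar _ (by omega)
  have hBfar : ∀ m, M₁ ≤ m → B m ≤ K * (m : ℝ) ^ (-s) := by
    intro m hm; have : ¬ m < M₁ := by omega
    simp [B, this]
  have hBe : Summable fun j => (((2 * (M + j) + n).choose n : ℕ) : ℝ) * B (M + j) := by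
    simpa using summable_choose_mul_of_eventually_le_rpow (n := n) (a := 0) (by omega) hB0 hs hBfar M
  have hBo : Summable fun j => (((2 * (M + j) + 1 + n).choose n : ℕ) : ℝ) * B (M + j) :=
    summable_choose_mul_of_eventually_le_rpow (n := n) (a := 1) le_rfl hB0 hs hBfar M
  have henc := srwI_succ_mem_Icc n hd x M hBq hBe hBo
  refine ⟨henc.1, henc.2.trans ?_⟩
  -- bound the two tails
  have hM₁ : 1 ≤ M₁ := le_trans hM hMM₁
  obtain ⟨L, rfl⟩ : ∃ L, M₁ = M + L := ⟨M₁ - M, by omega⟩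
  -- on the block range B = b
  have hBb : ∀ j, j < L → B (M + j) = b (M + j) := by
    intro j hj
    have h : M + j < M + L := by omega
    simp only [B, h, if_true]
    exact max_eq_left ((srwLaw_nonneg _ _).trans (hb _ (by omega) h))
  have htail : ∀ a : ℕ, a ≤ 1 →
      (Summable fun j => (((2 * (M + j) + a + n).choose n : ℕ) : ℝ) * B (M + j)) →
      ∑' j, (((2 * (M + j) + a + n).choose n : ℕ) : ℝ) * B (M + j)
        ≤ ∑ m ∈ Finset.Ico M (M + L), (((2 * m + a + n).choose n : ℕ) : ℝ) * b m +
          K * ((3 : ℝ) + n) ^ n * ((((M + L : ℕ) : ℝ)) ^ (-(s - n)) +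
            (((M + L : ℕ) : ℝ)) ^ (1 - (s - n)) / (s - n - 1)) := by
    intro a ha hsum
    rw [← hsum.sum_add_tsum_nat_add L]
    refine add_le_add ?_ ?_
    · rw [Finset.sum_Ico_eq_sum_range, Nat.add_sub_cancel_left]
      refine le_of_eq (Finset.sum_congr rfl fun j hj => ?_)
      rw [hBb j (Finset.mem_range.1 hj)]
    · have hfar' : ∀ j, B (M + L + j) ≤ K * (((M + L + j : ℕ) : ℝ)) ^ (-s) := fun j =>
        hBfar _ (by omega)
      have := tsum_choose_mul_le_of_le_rpow (n := n) (M := M + L) (a := a) (by omega) ha hs hK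
        (fun j => hB0 _) hfar'
      refine le_trans (le_of_eq ?_) this
      refine tsum_congr fun j => ?_
      simp only [add_assoc, add_comm j L, Nat.add_comm]
  have he := htail 0 (zero_le_one) (by simpa using hBe)
  have ho := htail 1 le_rfl hBo
  simp only [add_zero] at he
  have hs' : s - n = (d : ℝ) / 2 - n := by rw [hs_def]
  rw [hs'] at he ho
  push_cast at he ho ⊢
  linarith

end Literature.Probability.FitznerVanDerHofstad2017
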